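import Mathlib
import Literature.Topology.PlaneTopology.WindingNumber

/-!
# Zeros persist under uniform convergence on a circle (stub `helper_zerosPersist`, line Sketch)

Crux `stmt-SmoothPoincare4-7826` (`TameOrBrodyR4`), line `Sketch`, skeleton v16: persistence of
intersections of `J`-holomorphic curves. The limit's intersection is encoded by a zero of a map
`c : ℂ → ℂ` whose restriction to a small circle `‖z - ζ₂‖ = ε` has non-zero winding number; the
approximating curves give maps `d n`, continuous on the closed disc `‖z - ζ₂‖ ≤ ε` and converging
to `c` uniformly on the circle. Then each `d n` (`n` large) vanishes somewhere in the closed disc.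

Proof (winding numbers of the tree's `Literature.Topology.PlaneTopology.WindingNumber`): let
`m > 0` be the minimum of `‖c‖` on the (compact) circle; for `n` large `‖d n - c‖ < m ≤ ‖c‖` on the
circle, so the loops `d n ∘ γ` and `c ∘ γ` along the circle `γ` have the same winding number
(Rouché for loops, `wind_eq_of_norm_sub_lt`), which is `≠ 0`. If `d n` had no zero in the closed
disc it would have a continuous logarithm there (radial homotopy to a constant plus homotopy
lifting, `HasLogOn.of_homotopy`), forcing `wind (d n ∘ γ) = 0`
(`wind_comp_eq_zero_of_hasLogOn`), a contradiction.
-/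

set_option linter.dupNamespace false

noncomputable section

open Filter Set Metric
open scoped Topology
open Literature.Topology.PlaneTopology

namespace Summit.SmoothPoincare4.SmoothPoincare4.Cruxes.TameOrBrodyR4.Sketch

namespace ZerosPersist

/-- A continuous zero-free map on a closed disc has a continuous logarithm there (radial homotopy
to the constant value at the centre, and homotopy lifting). -/
theorem hasLogOn_closedBall {g : ℂ → ℂ} {a : ℂ} {r : ℝ} (hg : ContinuousOn g (closedBall a r))
    (hne : ∀ z ∈ closedBall a r, g z ≠ 0) : HasLogOn g (closedBall a r) := by
  rcases lt_or_ge r 0 with hr | hr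
  · rw [closedBall_eq_empty.2 hr]
    exact hasLogOn_empty g
  have hmem : ∀ t ∈ Icc (0 : ℝ) 1, ∀ z ∈ closedBall a r,
      a + (t : ℂ) * (z - a) ∈ closedBall a r := by
    intro t ht z hz
    rw [mem_closedBall_iff_norm] at hz ⊢
    rw [add_sub_cancel_left, norm_mul, Complex.norm_of_nonneg ht.1]
    nlinarith [ht.1, ht.2, norm_nonneg (z - a)]
  have hmaps : MapsTo (fun p : ℝ × ℂ => a + (p.1 : ℂ) * (p.2 - a)) (Icc 0 1 ×ˢ closedBall a r)
      (closedBall a r) := fun p hp => hmem p.1 hp.1 p.2 hp.2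
  have hcont : ContinuousOn (fun p : ℝ × ℂ => g (a + (p.1 : ℂ) * (p.2 - a)))
      (Icc 0 1 ×ˢ closedBall a r) := hg.comp (by fun_prop) hmaps
  exact HasLogOn.of_homotopy (f := fun _ => g a) (fun t z => g (a + (t : ℂ) * (z - a))) hcont
    (fun z _ => by simp) (fun z _ => by simp) (fun t ht z hz => hne _ (hmem t ht z hz))
    (hasLogOn_const (hne a (mem_closedBall_self hr)) _)

end ZerosPersist

/-- (WP) zeros persist: a uniform limit on a circle with non-zero winding number forces the
approximants (continuous on the closed disc) to vanish somewhere in the disc. -/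
theorem helper_zerosPersist (c : ℂ → ℂ) (d : ℕ → ℂ → ℂ) (ζ₂ : ℂ) (ε : ℝ) (hε : 0 < ε)
    (hc : ContinuousOn c (sphere ζ₂ ε)) (hcne : ∀ z ∈ sphere ζ₂ ε, c z ≠ 0)
    (hwind : Literature.Topology.PlaneTopology.wind
      (fun t => c (Literature.Topology.PlaneTopology.circleLoop ζ₂ ε t)) ≠ 0)
    (hd : ∀ n, ContinuousOn (d n) (closedBall ζ₂ ε))
    (hconv : TendstoUniformlyOn d c atTop (sphere ζ₂ ε)) :
    ∀ᶠ n in atTop, ∃ z ∈ closedBall ζ₂ ε, d n z = 0 := by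
  -- (1) a positive lower bound `m` of `‖c‖` on the compact circle
  have hsph_ne : (sphere ζ₂ ε).Nonempty :=
    ⟨circleLoop ζ₂ ε 0, circleLoop_mem_sphere ζ₂ hε.le 0⟩
  obtain ⟨z₀, hz₀, hmin⟩ := (isCompact_sphere ζ₂ ε).exists_isMinOn hsph_ne hc.norm
  have hm0 : 0 < ‖c z₀‖ := norm_pos_iff.2 (hcne z₀ hz₀)
  -- (2) eventually `d n` is uniformly `m`-close to `c` on the circle
  have hev : ∀ᶠ n in atTop, ∀ z ∈ sphere ζ₂ ε, dist (c z) (d n z) < ‖c z₀‖ :=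
    Metric.tendstoUniformlyOn_iff.1 hconv _ hm0
  refine hev.mono fun n hn => ?_
  -- the circle loop `γ` lies on the circle, hence in the closed disc
  have hγs : ∀ t, circleLoop ζ₂ ε t ∈ sphere ζ₂ ε := fun t => circleLoop_mem_sphere ζ₂ hε.le t
  have hγb : ∀ t, circleLoop ζ₂ ε t ∈ closedBall ζ₂ ε := fun t =>
    sphere_subset_closedBall (hγs t)
  -- (3) Rouché for loops: `wind (d n ∘ γ) = wind (c ∘ γ)`
  have hg : IsNonvanishingLoop (fun t => c (circleLoop ζ₂ ε t)) :=
    ⟨hc.comp (continuous_circleLoop ζ₂ ε).continuousOn fun t _ => hγs t,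
      fun t _ => hcne _ (hγs t), by rw [circleLoop_zero_eq]⟩
  have hf : ContinuousOn (fun t => d n (circleLoop ζ₂ ε t)) (Icc 0 1) :=
    (hd n).comp (continuous_circleLoop ζ₂ ε).continuousOn fun t _ => hγb t
  have hwn : wind (fun t => d n (circleLoop ζ₂ ε t)) =
      wind (fun t => c (circleLoop ζ₂ ε t)) := by
    refine wind_eq_of_norm_sub_lt hf (by rw [circleLoop_zero_eq]) hg fun t _ => ?_
    calc ‖d n (circleLoop ζ₂ ε t) - c (circleLoop ζ₂ ε t)‖
        = dist (c (circleLoop ζ₂ ε t)) (d n (circleLoop ζ₂ ε t)) := by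
          rw [dist_comm, dist_eq_norm]
      _ < ‖c z₀‖ := hn _ (hγs t)
      _ ≤ ‖c (circleLoop ζ₂ ε t)‖ := isMinOn_iff.1 hmin _ (hγs t)
  -- (4) no zero in the closed disc ⇒ a logarithm there ⇒ winding number zero: contradiction
  by_contra h
  push Not at h
  have hlog : HasLogOn (d n) (closedBall ζ₂ ε) := ZerosPersist.hasLogOn_closedBall (hd n) h
  have h0 : wind (fun t => d n (circleLoop ζ₂ ε t)) = 0 :=
    wind_comp_eq_zero_of_hasLogOn hlog (continuous_circleLoop ζ₂ ε).continuousOn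
      (fun t _ => hγb t) (circleLoop_zero_eq ζ₂ ε)
  exact hwind (hwn.symm.trans h0)

end Summit.SmoothPoincare4.SmoothPoincare4.Cruxes.TameOrBrodyR4.Sketch
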